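import Summits.QuantumFields.YangMills.Theorems.UnitScaleTiltProp7PinnedBiharmonicAgmonInterp
import HarnessLib

/-!
# Route `UnitScaleTilt`, crux K1 «MinimiserStabilityRegPr» (stmt-QuantumFields-19200), route-R E′ path (α′), sup row (hK) of
# ✓ `…CentreHarmonicInterpKernel.norm_grad_interp_error_le` — (D2′) AGMON, FILE 3∕3: ★★★ THE WEIGHTED-ENERGY (EXPONENTIAL) SCREENING
# ESTIMATE FOR THE PINNED BIHARMONIC LEAST-SQUARES PROBLEM ON `T^{(j)}`, MODULO (D1-glob) DISPLAYED VERBATIM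

Cell `ym3-torus`, D-0154 (3c) width seat `ym-routeR-w6` (gen 5), on ★routeR-w3 g5's «routeR-w6: GO (D2′)» 2026-08-28T18:22:37Z (interface (1)–(4) of
that line); `--supports stmt-QuantumFields-19200`, count-neutral.  THEOREMS ONLY (0 `def`, 0 `sorry`).  YM₃ on T³ is a ladder rung (R3), not the
Clay problem; nothing here claims the stub, the crux, d = 4 or the gap.

THE POINT.  (hK) `Σ_z|K(b,z)| ≤ c_I·ℓ` (✓p654411) = near field (N) + LOCALISATION of the pinned biharmonic solution operator at scale ℓ (D2) + assembly (A).
Here (D2) in energy form: for `e` pinned on `C` solving the least-squares Euler–Lagrange identity with THREE source types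
`Σ_x(Δe)(Δv) = Σ_x h·Δv + Σ_b h̃·∂v + Σ_x s·v` (all pinned `v`) — type 1 is the interpolation problem itself (`h = Δφ`, `el_of_biharmonic_off`) and the
smooth remainders `−[Δ,χ]Γ` met when (A) peels the explicit near-field dipole `χΓ` off the kernel; types 1.5∕2 are the once-integrated commutator
pieces `(∇²Γ·∇χ)·∂v`, `([Δ,χ]ΔΓ)·v` of that peeling — and for any weight `ω > 0` with displayed first∕second-difference constants `a ≤ 1∕2`, `b`:
`‖ωΔe‖ ≤ 3‖ωh‖ + 2(g₁ + γA′)‖ωh̃‖ + 2A′‖ωs‖`, `‖ωe‖ ≤ A′‖ωΔe‖`, `‖ω∂e‖ ≤ g₁‖ωΔe‖` (weighted `ℓ²` norms; `A′ ≈ 2A`, `g₁ ≈ √(2A′)`, `A = √C_P·ℓ²`)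
under two SCALE-FREE smallness rows `H1`, `H2` in `(a, b, c, C_P, ℓ, d)` — with `ω = e^{κρ∕ℓ}` (`a ≈ κ∕ℓ`, `b ≈ κ∕ℓ²`) every entry of `H1`, `H2` is
`O(κ + κ²)·(1 + C_P^{1∕2})`: EXPONENTIAL SCREENING AT RATE `κ∕ℓ`, `κ = κ(C_P, d)` absolute — px17's measured ×10–20 per block (18:17:59Z) in theorem form,
modulo (D1-glob).  PROOF = Agmon: Poincaré for `ωe` + file 1's commutator bound (θ = 1) + file 2's interpolation ⇒ `‖ωe‖ ≤ A′‖ωΔe‖`; then the EL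
identity tested with `v = ω²e`, the `ω²`-commutator read through `θ = ω⁻¹`, Cauchy–Schwarz; no Combes–Thomas, no Fourier.

WHAT IS PROVED (ns `…Theorems.Prop7PinnedBiharmonicAgmonDecay`; real site fields; `C : Set (Site P j)` abstract — `range (embIter k)` at the consumer).
* §6 ★★★ `weighted_laplace_le_core` — the estimate with the pinned Poincaré row in ROOT form `√Σv² ≤ A·√Σ(Δv)²` and the three source types.
* §7 ★ `el_of_biharmonic_off` (the EL identity of `e = φ − φ_H` from `Δ²φ_H = 0` off `C`: type-1 source `h = Δφ`, zero bond∕site sources),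
  `poincare_root_of_sq` ((D1-glob) verbatim ⇒ root form, `A = √C_P·ℓ²`), ★★★ `weighted_laplace_le` — the interpolation-error instance with (D1-glob)
  displayed VERBATIM `∀ v, v|_C = 0 → Σ_x v² ≤ C_P·ℓ⁴·Σ_x(Δv)²` (★routeR-w3 g5 (2); = routeR-w2 g5's (D1-cell) summed over cells + `Σ‖∇²v‖² = Σ(Δv)²`):
  `‖ωΔ(φ − φ_H)‖ ≤ 3‖ωΔφ‖`, `‖ω(φ − φ_H)‖ ≤ A′‖ωΔ(φ − φ_H)‖`, `‖ω∂(φ − φ_H)‖ ≤ g₁‖ωΔ(φ − φ_H)‖`.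
HONEST SCOPE.  (D1-glob) is DISPLAYED, not proved (routeR-w2 g5's pen); the weight `ω` with its two constants is DISPLAYED (any `ω` works — the
consumer takes `ω = exp(κρ∕ℓ)` with `ρ` a window-averaged torus distance, `a ≤ 2κ∕ℓ`, `b ≤ 3κ∕ℓ²`); constants ours and crude; the near field (N),
the peeling and the `ℓ²→ℓ¹` conversion of (hK) are NOT here (routeR-w3 lineage).  Nothing of [Balaban1984PropagatorsII] is asserted beyond the cited
shape «exponential decay of constrained propagators at the block scale» ((1.9) p.226), of which this is an energy-method instance for point pins.

References: T. Bałaban, CMP 96 (1984) 223–250 [Balaban1984PropagatorsII] ((1.9) p.226); CMP 99 (1985) 75–102 [Balaban1985RegularSpaces] ((1.14) p.78,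
(1.36) p.82); CMP 102 (1985) 277–309 [Balaban1985Variational] (Prop. 7 p.299); S. Agmon, Princeton Math. Notes 29 (1982) (method);
W. R. Madych, S. A. Nelson, J. Approx. Theory 60 (1990) 141–156 (cardinal polyharmonic splines: the continuum face of the decay).
-/

set_option autoImplicit false

noncomputable section

open scoped BigOperators

namespace Summit.QuantumFields.YangMills.Theorems.Prop7PinnedBiharmonicAgmonDecay

open Literature.MathematicalPhysics.QuantumFieldTheory.Balaban1983to89
open Finset LatticeFieldCalculus
open B10StarCount (sum_pbond shift_unshift unshift_shift)
open Summit.QuantumFields.YangMills.Theorems.Prop7CentreHarmonicInterpKernel (sum_comp_shift sum_comp_unshift' laplace_sub')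
open Summit.QuantumFields.YangMills.Theorems.Prop7PinnedHodgeSplit (sum_mul_laplace_eq_sum_grad_mul sum_mul_laplace_comm)
open Summit.QuantumFields.YangMills.Theorems.Prop7PinnedBiharmonicAgmonLetters
open Summit.QuantumFields.YangMills.Theorems.Prop7PinnedBiharmonicAgmonInterp

variable {P : Params} {j : ℕ}

/-! ## §6 ★★★ THE AGMON ESTIMATE — weighted `ℓ²` control of `Δe`, `e`, `∂e` by the weighted `ℓ²` size of the source -/

set_option maxHeartbeats 400000 in
/-- ★★★ **(D2′) AGMON, CORE FORM.**  Torus `T^{(j)}`, lattice factor `c`, centre set `C`, real site fields.  DATA: a weight `ω > 0`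
with first-difference constant `a ≤ 1/2` (`|ω(x±e_μ) − ω(x)| ≤ aω(x)`) and second-difference constant `b` (`|ω(x+e_μ) + ω(x−e_μ) −
2ω(x)| ≤ bω(x)`); the PINNED POINCARÉ row in root form `√Σv² ≤ A·√Σ(Δv)²` for every `v` vanishing on `C` ((D1-glob): `A = √C_P·ℓ²`); a
pinned `e` (`e|_C = 0`) satisfying the EULER–LAGRANGE identity of the pinned least-squares problem with THREE source types,
`Σ(Δe)(Δv) = Σ h·Δv + Σ_b h̃·∂v + Σ s·v` for all pinned `v`; and the two scale-free smallness rows `H1`, `H2` in the derived constants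
`p = √(10d)·A·a|c|`, `γ = (15/4)a|c|√d`, `A′ = 2A + 4p²`, `g₁ = √(2A′ + γ²A′²)`, `τ = √(10d)(5a/2)|c|g₁ + √3·d(2a²+2b)c²A′`.  THEN
`√Σ(ωΔe)² ≤ 3√Σ(ωh)² + 2(g₁ + γA′)√Σ_b(ω(b₋)h̃(b))² + 2A′√Σ(ωs)²`, `√Σ(ωe)² ≤ A′√Σ(ωΔe)²`, `√Σ_b(ω(b₋)∂e(b))² ≤ g₁√Σ(ωΔe)²`.
With `ω = e^{κρ/ℓ}` (`a ≈ κ/ℓ`, `b ≈ κ/ℓ²`, `A = √C_P ℓ²`) all of `p/√A, γ√A, τ` are `O(κ)`: exponential screening at rate `κ/ℓ`, `κ = κ(C_P, d)`.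
Proof: Poincaré for `ωe` + the commutator bound (θ = 1) + the weighted interpolation ⇒ `N ≤ A′E`; then the EL identity tested with
`v = ω²e`, the commutator bound for `ω²` read through `θ = ω⁻¹`, Cauchy–Schwarz. [folklore] [cite: Balaban1984PropagatorsII, (1.9) p.226] -/
theorem weighted_laplace_le_core (c : ℝ) (C : Set (Site P j)) (ω e h s : SiteField P j ℝ) (ht : VecField P j ℝ)
    {a b A p γ A' g₁ τ : ℝ} (ha0 : 0 ≤ a) (ha : a ≤ 1 / 2) (hb0 : 0 ≤ b) (hA : 0 ≤ A)
    (hω₀ : ∀ x, 0 < ω x)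
    (hω₁ : ∀ x μ, |ω (x.shift μ) - ω x| ≤ a * ω x ∧ |ω (x.unshift μ) - ω x| ≤ a * ω x)
    (hω₂ : ∀ x μ, |ω (x.shift μ) + ω (x.unshift μ) - 2 * ω x| ≤ b * ω x)
    (hP : ∀ v : SiteField P j ℝ, (∀ y ∈ C, v y = 0) →
      Real.sqrt (∑ x, v x ^ 2) ≤ A * Real.sqrt (∑ x, laplace c v x ^ 2))
    (he : ∀ y ∈ C, e y = 0)
    (hEL : ∀ v : SiteField P j ℝ, (∀ y ∈ C, v y = 0) →
      ∑ x, laplace c e x * laplace c v x = ∑ x, h x * laplace c v x + ∑ b, ht b * grad c v b + ∑ x, s x * v x)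
    (hp : p = Real.sqrt (10 * P.d) * A * a * |c|) (hγ : γ = 15 / 4 * a * |c| * Real.sqrt P.d) (hA' : A' = 2 * A + 4 * p ^ 2)
    (hg₁ : g₁ = Real.sqrt (2 * A' + γ ^ 2 * A' ^ 2))
    (hτ : τ = Real.sqrt (10 * P.d) * (5 / 2 * a) * |c| * g₁ + Real.sqrt 3 * P.d * (2 * a ^ 2 + 2 * b) * c ^ 2 * A')
    (H1 : p * γ + Real.sqrt 3 * P.d * b * c ^ 2 * A ≤ 1 / 4) (H2 : τ ≤ 1 / 2) :
    Real.sqrt (∑ x, (ω x * laplace c e x) ^ 2)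
        ≤ 3 * Real.sqrt (∑ x, (ω x * h x) ^ 2) + 2 * (g₁ + γ * A') * Real.sqrt (∑ b, (ω b.src * ht b) ^ 2)
          + 2 * A' * Real.sqrt (∑ x, (ω x * s x) ^ 2)
      ∧ Real.sqrt (∑ x, (ω x * e x) ^ 2) ≤ A' * Real.sqrt (∑ x, (ω x * laplace c e x) ^ 2)
      ∧ Real.sqrt (∑ b, (ω b.src * grad c e b) ^ 2) ≤ g₁ * Real.sqrt (∑ x, (ω x * laplace c e x) ^ 2) := by
  have hd : (0 : ℝ) ≤ P.d := Nat.cast_nonneg _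
  -- the six weighted norms
  set E := Real.sqrt (∑ x, (ω x * laplace c e x) ^ 2) with hEdef
  set N := Real.sqrt (∑ x, (ω x * e x) ^ 2) with hNdef
  set G := Real.sqrt (∑ b, (ω b.src * grad c e b) ^ 2) with hGdef
  set H := Real.sqrt (∑ x, (ω x * h x) ^ 2) with hHdef
  set Ht := Real.sqrt (∑ b, (ω b.src * ht b) ^ 2) with hHtdef
  set S := Real.sqrt (∑ x, (ω x * s x) ^ 2) with hSdef
  have hE0 : 0 ≤ E := Real.sqrt_nonneg _
  have hN0 : 0 ≤ N := Real.sqrt_nonneg _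
  have hG0 : 0 ≤ G := Real.sqrt_nonneg _
  have hH0 : 0 ≤ H := Real.sqrt_nonneg _
  have hHt0 : 0 ≤ Ht := Real.sqrt_nonneg _
  have hS0 : 0 ≤ S := Real.sqrt_nonneg _
  have hNsq : N ^ 2 = ∑ x, (ω x * e x) ^ 2 := Real.sq_sqrt (Finset.sum_nonneg fun _ _ => sq_nonneg _)
  have hGsq : G ^ 2 = ∑ b, (ω b.src * grad c e b) ^ 2 := Real.sq_sqrt (Finset.sum_nonneg fun _ _ => sq_nonneg _)
  have hEsq : E ^ 2 = ∑ x, (ω x * laplace c e x) ^ 2 := Real.sq_sqrt (Finset.sum_nonneg fun _ _ => sq_nonneg _)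
  have hp0 : 0 ≤ p := by rw [hp]; positivity
  have hγ0 : 0 ≤ γ := by rw [hγ]; positivity
  have hA'0 : 0 ≤ A' := by rw [hA']; positivity
  have hg₁0 : 0 ≤ g₁ := by rw [hg₁]; positivity
  ------------------------------------------------------------------
  -- STEP I: weighted interpolation `G² ≤ 2NE + γ²N²`
  have hI : G ^ 2 ≤ 2 * N * E + γ ^ 2 * N ^ 2 := by
    rw [hGsq, hNsq, hγ]; exact weighted_grad_sq_le c ω e ha0 ha hω₀ hω₁
  ------------------------------------------------------------------
  -- STEP P: Poincaré for `ωe` and the `θ = 1` commutator ⇒ `N ≤ A(E + √(10d)a|c|G + √3 d b c² N)`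
  have hpin : ∀ y ∈ C, (fun x => ω x * e x) y = 0 := fun y hy => by simp [he y hy]
  have hR₁ : Real.sqrt (∑ x, (laplace c (fun y => ω y * e y) x - ω x * laplace c e x) ^ 2)
      ≤ Real.sqrt (10 * P.d) * a * |c| * G + Real.sqrt 3 * P.d * b * c ^ 2 * N := by
    have h1 := sum_sq_weighted_comm_le c ω ω (fun _ => (1 : ℝ)) e ha hω₀ hω₁ (fun _ => zero_le_one)
      (fun x μ => by simpa only [one_mul] using hω₁ x μ) (fun x μ => by simpa only [one_mul] using hω₂ x μ)
    simp only [one_mul] at h1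
    refine (Real.sqrt_le_sqrt h1).trans ?_
    rw [← hGsq, ← hNsq]
    exact sqrt_comm_bound_le ha0 hb0 (sq_nonneg _) (sq_nonneg _) |>.trans_eq (by rw [Real.sqrt_sq hG0, Real.sqrt_sq hN0])
  have hP1 : N ≤ A * E + p * G + Real.sqrt 3 * P.d * b * c ^ 2 * A * N := by
    have h1 := hP _ hpin
    have h2 : Real.sqrt (∑ x, laplace c (fun y => ω y * e y) x ^ 2)
        ≤ E + Real.sqrt (∑ x, (laplace c (fun y => ω y * e y) x - ω x * laplace c e x) ^ 2) := by
      have h := sqrt_sum_univ_add_sq_le (fun x => ω x * laplace c e x)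
        (fun x => laplace c (fun y => ω y * e y) x - ω x * laplace c e x)
      have e1 : ∑ x, ((fun x => ω x * laplace c e x) x + (fun x => laplace c (fun y => ω y * e y) x - ω x * laplace c e x) x) ^ 2
          = ∑ x, laplace c (fun y => ω y * e y) x ^ 2 := Finset.sum_congr rfl fun x _ => by ring
      rw [e1] at h; exact h
    have h3 := h2.trans (add_le_add le_rfl hR₁)
    calc N ≤ A * Real.sqrt (∑ x, laplace c (fun y => ω y * e y) x ^ 2) := h1
      _ ≤ A * (E + (Real.sqrt (10 * P.d) * a * |c| * G + Real.sqrt 3 * P.d * b * c ^ 2 * N)) :=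
          mul_le_mul_of_nonneg_left h3 hA
      _ = A * E + p * G + Real.sqrt 3 * P.d * b * c ^ 2 * A * N := by rw [hp]; ring
  -- absorb: `pG ≤ N/4 + 2p²E + pγN`
  have hpG : p * G ≤ N / 4 + 2 * p ^ 2 * E + p * γ * N := by
    have hR : 0 ≤ N / 4 + 2 * p ^ 2 * E + p * γ * N := by positivity
    have k0 : (p * G) ^ 2 ≤ p ^ 2 * (2 * N * E + γ ^ 2 * N ^ 2) := by
      rw [mul_pow]; exact mul_le_mul_of_nonneg_left hI (sq_nonneg p)
    have k1 : p ^ 2 * (2 * N * E + γ ^ 2 * N ^ 2) ≤ (N / 4 + 2 * p ^ 2 * E + p * γ * N) ^ 2 := by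
      have e1 : (N / 4 + 2 * p ^ 2 * E + p * γ * N) ^ 2 - p ^ 2 * (2 * N * E + γ ^ 2 * N ^ 2)
          = (N / 4 - 2 * p ^ 2 * E) ^ 2 + 2 * ((N / 4 + 2 * p ^ 2 * E) * (p * γ * N)) := by ring
      have e2 : 0 ≤ (N / 4 - 2 * p ^ 2 * E) ^ 2 + 2 * ((N / 4 + 2 * p ^ 2 * E) * (p * γ * N)) := by positivity
      linarith [e1, e2]
    exact (abs_le_of_sq_le_sq' (k0.trans k1) hR).2
  have hN : N ≤ A' * E := by
    have h1 : (p * γ + Real.sqrt 3 * P.d * b * c ^ 2 * A) * N ≤ 1 / 4 * N := mul_le_mul_of_nonneg_right H1 hN0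
    have e1 : (p * γ + Real.sqrt 3 * P.d * b * c ^ 2 * A) * N = p * γ * N + Real.sqrt 3 * P.d * b * c ^ 2 * A * N := by ring
    have h2 : N ≤ 2 * (A * E) + 2 * (2 * p ^ 2 * E) := by linarith [hP1, hpG, h1, e1]
    calc N ≤ 2 * (A * E) + 2 * (2 * p ^ 2 * E) := h2
      _ = A' * E := by rw [hA']; ring
  ------------------------------------------------------------------
  -- STEP G: `G ≤ g₁ E`
  have hG : G ≤ g₁ * E := by
    have h1 : G ^ 2 ≤ (g₁ * E) ^ 2 := by
      have h2 : N * E ≤ A' * E * E := mul_le_mul_of_nonneg_right hN hE0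
      have h3 : γ ^ 2 * N ^ 2 ≤ γ ^ 2 * (A' * E) ^ 2 := mul_le_mul_of_nonneg_left (pow_le_pow_left₀ hN0 hN 2) (sq_nonneg γ)
      have hg₁sq : g₁ ^ 2 = 2 * A' + γ ^ 2 * A' ^ 2 := by rw [hg₁]; exact Real.sq_sqrt (by positivity)
      calc G ^ 2 ≤ 2 * N * E + γ ^ 2 * N ^ 2 := hI
        _ ≤ 2 * (A' * E * E) + γ ^ 2 * (A' * E) ^ 2 := by linarith [h2, h3]
        _ = g₁ ^ 2 * E ^ 2 := by rw [hg₁sq]; ring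
        _ = (g₁ * E) ^ 2 := by ring
    exact (abs_le_of_sq_le_sq' h1 (by positivity)).2
  ------------------------------------------------------------------
  -- STEP EL: test the Euler–Lagrange identity with `v = ω²e`
  have hpin2 : ∀ y ∈ C, (fun x => ω x ^ 2 * e x) y = 0 := fun y hy => by simp [he y hy]
  have hEL2 := hEL _ hpin2
  -- the `ω²` commutator, read through `ω⁻¹`
  set R₂ : SiteField P j ℝ := fun x => laplace c (fun y => ω y ^ 2 * e y) x - ω x ^ 2 * laplace c e x with hR₂def
  set R := Real.sqrt (∑ x, ((ω x)⁻¹ * R₂ x) ^ 2) with hRdef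
  have hR0 : 0 ≤ R := Real.sqrt_nonneg _
  have hRle : R ≤ τ * E := by
    have rows := fun x μ => sq_weight_rows ω ha0 ha hω₀ hω₁ hω₂ x μ
    have h1 := sum_sq_weighted_comm_le c ω (fun y => ω y ^ 2) (fun y => (ω y)⁻¹) e ha hω₀ hω₁
      (fun x => (inv_pos.mpr (hω₀ x)).le) (fun x μ => (rows x μ).1) (fun x μ => (rows x μ).2)
    have h2 : R ≤ Real.sqrt (10 * P.d) * (5 / 2 * a) * |c| * G + Real.sqrt 3 * P.d * (2 * a ^ 2 + 2 * b) * c ^ 2 * N := by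
      refine (Real.sqrt_le_sqrt h1).trans ?_
      rw [← hGsq, ← hNsq]
      exact sqrt_comm_bound_le (by positivity) (by positivity) (sq_nonneg _) (sq_nonneg _) |>.trans_eq
        (by rw [Real.sqrt_sq hG0, Real.sqrt_sq hN0])
    have h3 : Real.sqrt (10 * P.d) * (5 / 2 * a) * |c| * G ≤ Real.sqrt (10 * P.d) * (5 / 2 * a) * |c| * (g₁ * E) :=
      mul_le_mul_of_nonneg_left hG (by positivity)
    have h4 : Real.sqrt 3 * P.d * (2 * a ^ 2 + 2 * b) * c ^ 2 * N ≤ Real.sqrt 3 * P.d * (2 * a ^ 2 + 2 * b) * c ^ 2 * (A' * E) :=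
      mul_le_mul_of_nonneg_left hN (by positivity)
    calc R ≤ _ := h2
      _ ≤ Real.sqrt (10 * P.d) * (5 / 2 * a) * |c| * (g₁ * E) + Real.sqrt 3 * P.d * (2 * a ^ 2 + 2 * b) * c ^ 2 * (A' * E) :=
          add_le_add h3 h4
      _ = τ * E := by rw [hτ]; ring
  -- LHS from below: `Σ Δe·Δ(ω²e) = E² + Σ (ωΔe)(ω⁻¹R₂) ≥ E² − E·R`
  have hL : E ^ 2 - E * R ≤ ∑ x, laplace c e x * laplace c (fun y => ω y ^ 2 * e y) x := by
    have e1 : ∑ x, laplace c e x * laplace c (fun y => ω y ^ 2 * e y) x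
        = ∑ x, (ω x * laplace c e x) ^ 2 + ∑ x, (ω x * laplace c e x) * ((ω x)⁻¹ * R₂ x) := by
      rw [← Finset.sum_add_distrib]
      refine Finset.sum_congr rfl fun x _ => ?_
      have hx1 : ω x * (ω x)⁻¹ = 1 := mul_inv_cancel₀ (hω₀ x).ne'
      simp only [hR₂def]
      linear_combination (-(laplace c e x * laplace c (fun y => ω y ^ 2 * e y) x - ω x ^ 2 * laplace c e x ^ 2)) * hx1
    rw [e1, ← hEsq]
    have := neg_sqrt_mul_sqrt_le_sum_mul Finset.univ (fun x => ω x * laplace c e x) (fun x => (ω x)⁻¹ * R₂ x)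
    linarith
  -- T1: `Σ hΔ(ω²e) ≤ H(E + R)`
  have hT1 : ∑ x, h x * laplace c (fun y => ω y ^ 2 * e y) x ≤ H * E + H * R := by
    have e1 : ∑ x, h x * laplace c (fun y => ω y ^ 2 * e y) x
        = ∑ x, (ω x * h x) * (ω x * laplace c e x) + ∑ x, (ω x * h x) * ((ω x)⁻¹ * R₂ x) := by
      rw [← Finset.sum_add_distrib]
      refine Finset.sum_congr rfl fun x _ => ?_
      have hx1 : ω x * (ω x)⁻¹ = 1 := mul_inv_cancel₀ (hω₀ x).ne'
      simp only [hR₂def]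
      linear_combination (-(h x * laplace c (fun y => ω y ^ 2 * e y) x - ω x ^ 2 * h x * laplace c e x)) * hx1
    rw [e1]
    exact add_le_add (Real.sum_mul_le_sqrt_mul_sqrt _ _ _) (Real.sum_mul_le_sqrt_mul_sqrt _ _ _)
  -- T2: `Σ_b h̃ ∂(ω²e) ≤ Ht (G + γN)`
  have hT2 : ∑ b, ht b * grad c (fun y => ω y ^ 2 * e y) b ≤ Ht * G + Ht * (γ * N) := by
    have e1 : ∑ b, ht b * grad c (fun y => ω y ^ 2 * e y) b
        = ∑ b, (ω b.src * ht b) * (ω b.src * grad c e b)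
          + ∑ b, (ω b.src * ht b) * ((ω b.src)⁻¹ * (c * (ω b.tgt ^ 2 - ω b.src ^ 2) * e b.tgt)) := by
      rw [← Finset.sum_add_distrib]
      refine Finset.sum_congr rfl fun b _ => ?_
      have hx1 : ω b.src * (ω b.src)⁻¹ = 1 := mul_inv_cancel₀ (hω₀ _).ne'
      rw [grad_mul' c (fun y => ω y ^ 2) e b]
      linear_combination (-(ht b * (c * (ω b.tgt ^ 2 - ω b.src ^ 2) * e b.tgt))) * hx1
    rw [e1]
    refine add_le_add (Real.sum_mul_le_sqrt_mul_sqrt _ _ _) ((Real.sum_mul_le_sqrt_mul_sqrt _ _ _).trans ?_)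
    refine mul_le_mul_of_nonneg_left ?_ hHt0
    -- `√Σ_b (ω₋⁻¹ c(ω₊²−ω₋²)e₊)² ≤ γN`
    have hterm : ∀ b : PBond P j, ((ω b.src)⁻¹ * (c * (ω b.tgt ^ 2 - ω b.src ^ 2) * e b.tgt)) ^ 2
        ≤ (15 / 4 * a * |c|) ^ 2 * (ω b.tgt * e b.tgt) ^ 2 := by
      intro b
      have hs : 0 < ω b.src := hω₀ _
      have ht' : 0 < ω b.tgt := hω₀ _
      have r1 := (sq_weight_rows ω ha0 ha hω₀ hω₁ hω₂ b.src b.dir).1.1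
      have hst : ω b.src ≤ 3 / 2 * ω b.tgt := by
        have := weight_unshift_le ω ha hω₀ hω₁ b.tgt b.dir
        rwa [show b.tgt.unshift b.dir = b.src from unshift_shift b.src b.dir] at this
      have k : |(ω b.src)⁻¹ * (c * (ω b.tgt ^ 2 - ω b.src ^ 2) * e b.tgt)| ≤ 15 / 4 * a * |c| * (ω b.tgt * |e b.tgt|) := by
        rw [abs_mul, abs_mul, abs_mul, abs_of_pos (inv_pos.mpr hs)]
        calc (ω b.src)⁻¹ * (|c| * |ω b.tgt ^ 2 - ω b.src ^ 2| * |e b.tgt|)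
            = |c| * ((ω b.src)⁻¹ * |ω (b.src.shift b.dir) ^ 2 - ω b.src ^ 2|) * |e b.tgt| := by
              simp only [PBond.tgt]; ring
          _ ≤ |c| * (5 / 2 * a * ω b.src) * |e b.tgt| := by gcongr
          _ ≤ |c| * (5 / 2 * a * (3 / 2 * ω b.tgt)) * |e b.tgt| := by gcongr
          _ = 15 / 4 * a * |c| * (ω b.tgt * |e b.tgt|) := by ring
      have k2 := pow_le_pow_left₀ (abs_nonneg _) k 2
      rw [sq_abs] at k2
      refine k2.trans_eq ?_
      rw [mul_pow, mul_pow (ω b.tgt), sq_abs, ← mul_pow (ω b.tgt)]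
    have hsum : ∑ b : PBond P j, ((ω b.src)⁻¹ * (c * (ω b.tgt ^ 2 - ω b.src ^ 2) * e b.tgt)) ^ 2 ≤ (γ * N) ^ 2 := by
      refine (Finset.sum_le_sum fun b _ => hterm b).trans_eq ?_
      rw [← Finset.mul_sum, sum_bond_tgt (fun y => (ω y * e y) ^ 2), ← hNsq, hγ, mul_pow, mul_pow, mul_pow, mul_pow,
        Real.sq_sqrt hd]
      ring
    exact (Real.sqrt_le_sqrt hsum).trans_eq (Real.sqrt_sq (by positivity))
  -- T3: `Σ s ω²e ≤ S N`
  have hT3 : ∑ x, s x * (fun y => ω y ^ 2 * e y) x ≤ S * N := by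
    have e1 : ∑ x, s x * (fun y => ω y ^ 2 * e y) x = ∑ x, (ω x * s x) * (ω x * e x) :=
      Finset.sum_congr rfl fun x _ => by simp only; ring
    rw [e1]; exact Real.sum_mul_le_sqrt_mul_sqrt _ _ _
  ------------------------------------------------------------------
  -- COMBINE
  have hmain : E ^ 2 ≤ τ * E ^ 2 + (1 + τ) * H * E + ((g₁ + γ * A') * Ht + A' * S) * E := by
    have h1 : E ^ 2 - E * R ≤ H * E + H * R + (Ht * G + Ht * (γ * N)) + S * N := by
      have := hEL2; rw [this] at hL; linarith [hT1, hT2, hT3]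
    have h2 : E * R ≤ E * (τ * E) := mul_le_mul_of_nonneg_left hRle hE0
    have h3 : H * R ≤ H * (τ * E) := mul_le_mul_of_nonneg_left hRle hH0
    have h4 : Ht * G ≤ Ht * (g₁ * E) := mul_le_mul_of_nonneg_left hG hHt0
    have h5 : Ht * (γ * N) ≤ Ht * (γ * (A' * E)) := mul_le_mul_of_nonneg_left (mul_le_mul_of_nonneg_left hN hγ0) hHt0
    have h6 : S * N ≤ S * (A' * E) := mul_le_mul_of_nonneg_left hN hS0
    calc E ^ 2 ≤ E * R + H * E + H * R + (Ht * G + Ht * (γ * N)) + S * N := by linarith [h1]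
      _ ≤ E * (τ * E) + H * E + H * (τ * E) + (Ht * (g₁ * E) + Ht * (γ * (A' * E))) + S * (A' * E) :=
          add_le_add (add_le_add (add_le_add (add_le_add h2 le_rfl) h3) (add_le_add h4 h5)) h6
      _ = τ * E ^ 2 + (1 + τ) * H * E + ((g₁ + γ * A') * Ht + A' * S) * E := by ring
  have hτ0 : 0 ≤ τ := by rw [hτ]; positivity
  have hK0 : 0 ≤ (g₁ + γ * A') * Ht + A' * S := by positivity
  have hfin : E ≤ 3 * H + 2 * (g₁ + γ * A') * Ht + 2 * A' * S := by
    by_cases hE : E = 0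
    · rw [hE]; positivity
    · have hEpos : 0 < E := lt_of_le_of_ne hE0 (Ne.symm hE)
      have h0 : E * E ≤ (τ * E + (1 + τ) * H + ((g₁ + γ * A') * Ht + A' * S)) * E := by
        have e1 : (τ * E + (1 + τ) * H + ((g₁ + γ * A') * Ht + A' * S)) * E
            = τ * E ^ 2 + (1 + τ) * H * E + ((g₁ + γ * A') * Ht + A' * S) * E := by ring
        rw [e1, ← pow_two]; exact hmain
      have h1 : E ≤ τ * E + (1 + τ) * H + ((g₁ + γ * A') * Ht + A' * S) := le_of_mul_le_mul_right h0 hEpos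
      have h2 : τ * E ≤ 1 / 2 * E := mul_le_mul_of_nonneg_right H2 hE0
      have h3 : τ * H ≤ 1 / 2 * H := mul_le_mul_of_nonneg_right H2 hH0
      have e2 : (1 + τ) * H = H + τ * H := by ring
      linarith [h1, h2, h3, e2]
  exact ⟨hfin, hN, hG⟩

/-! ## §7 Feeding the estimate: the Euler–Lagrange identity of the pinned biharmonic interpolant, and (D1-glob) verbatim -/

/-- **THE EULER–LAGRANGE IDENTITY OF THE PINNED BIHARMONIC INTERPOLANT** (type-1 source `h = Δφ`, no bond∕site sources): if `φ_H` is
biharmonic off `C` (`Δ²φ_H = 0` off `C`, ✓ `…CentreHarmonicRegaugeSup`'s `hEL`), then for every `v` vanishing on `C`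
`Σ_x Δ(φ − φ_H)·Δv = Σ_x Δφ·Δv + Σ_b 0·∂v + Σ_x 0·v` (two summations by parts move `Δ` onto `φ_H`; the boundary lives on `C` where `v = 0`).
[cite: Balaban1985Variational, Prop. 7 p.299] -/
theorem el_of_biharmonic_off (c : ℝ) (C : Set (Site P j)) (φ φH : SiteField P j ℝ)
    (hEL : ∀ x ∉ C, laplace c (laplace c φH) x = 0) (v : SiteField P j ℝ) (hv : ∀ y ∈ C, v y = 0) :
    ∑ x, laplace c (fun y => φ y - φH y) x * laplace c v x
      = ∑ x, laplace c φ x * laplace c v x + ∑ b : PBond P j, (fun _ => (0 : ℝ)) b * grad c v b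
        + ∑ x, (fun _ => (0 : ℝ)) x * v x := by
  have h0 : ∑ x, laplace c φH x * laplace c v x = 0 := by
    rw [sum_mul_laplace_comm]
    refine Finset.sum_eq_zero fun x _ => ?_
    by_cases hx : x ∈ C
    · rw [hv x hx, mul_zero]
    · rw [hEL x hx, zero_mul]
  have hsub : ∀ x, laplace c (fun y => φ y - φH y) x = laplace c φ x - laplace c φH x := fun x => congrFun (laplace_sub' c φ φH) x
  simp only [hsub, sub_mul, Finset.sum_sub_distrib, h0, zero_mul, Finset.sum_const_zero, add_zero, sub_zero]

/-- **(D1-glob) VERBATIM ⇒ ROOT FORM**: `Σ_x v² ≤ C_P·ℓ⁴·Σ_x (Δv)²` for pinned `v` gives `√Σv² ≤ (√C_P·ℓ²)·√Σ(Δv)²`. [folklore] -/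
theorem poincare_root_of_sq (c : ℝ) (C : Set (Site P j)) {CP ℓ : ℝ} (hCP : 0 ≤ CP)
    (hP : ∀ v : SiteField P j ℝ, (∀ y ∈ C, v y = 0) → ∑ x, v x ^ 2 ≤ CP * ℓ ^ 4 * ∑ x, laplace c v x ^ 2)
    (v : SiteField P j ℝ) (hv : ∀ y ∈ C, v y = 0) :
    Real.sqrt (∑ x, v x ^ 2) ≤ (Real.sqrt CP * ℓ ^ 2) * Real.sqrt (∑ x, laplace c v x ^ 2) := by
  refine (Real.sqrt_le_sqrt (hP v hv)).trans_eq ?_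
  rw [Real.sqrt_mul (by positivity), Real.sqrt_mul hCP, show ℓ ^ 4 = (ℓ ^ 2) ^ 2 by ring, Real.sqrt_sq (sq_nonneg ℓ)]

set_option maxHeartbeats 400000 in
/-- ★★★ **(D2′) AGMON FOR THE PINNED BIHARMONIC INTERPOLATION ERROR, (D1-glob) DISPLAYED VERBATIM.**  `φ` any real site function, `φ_H` a
pinned interpolant of `φ|_C` (`φ_H|_C = φ|_C`) biharmonic off `C`; `e := φ − φ_H`.  Under the weight rows (`a ≤ 1/2`, `b`), (D1-glob)
`∀ v, v|_C = 0 → Σ_x v² ≤ C_P ℓ⁴ Σ_x (Δv)²`, and the two smallness rows in `A = √C_P·ℓ²`: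
`√Σ(ωΔe)² ≤ 3·√Σ(ωΔφ)²`, `√Σ(ωe)² ≤ A′·√Σ(ωΔe)²`, `√Σ_b(ω(b₋)∂e(b))² ≤ g₁·√Σ(ωΔe)²` — weighted `ℓ²` control of the
interpolation error by the weighted `ℓ²` size of `Δφ` alone; with `ω = e^{κρ/ℓ}` this is exponential screening at rate `κ/ℓ`, and by
superposition over source blocks it gives the scale-ℓ-LOCAL `ℓ²` bounds `Σ_{B_ℓ}(Δe)² ≲ ℓ³·sup|Δφ|²` that (hK)'s assembly consumes
(the peeled remainders go through `weighted_laplace_le_core`). [cite: Balaban1984PropagatorsII, (1.9) p.226; Balaban1985RegularSpaces, (1.36) p.82] -/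
theorem weighted_laplace_le (c : ℝ) (C : Set (Site P j)) (ω φ φH : SiteField P j ℝ)
    {a b CP ℓ p γ A' g₁ τ : ℝ} (ha0 : 0 ≤ a) (ha : a ≤ 1 / 2) (hb0 : 0 ≤ b) (hCP : 0 ≤ CP)
    (hω₀ : ∀ x, 0 < ω x)
    (hω₁ : ∀ x μ, |ω (x.shift μ) - ω x| ≤ a * ω x ∧ |ω (x.unshift μ) - ω x| ≤ a * ω x)
    (hω₂ : ∀ x μ, |ω (x.shift μ) + ω (x.unshift μ) - 2 * ω x| ≤ b * ω x)
    (hP : ∀ v : SiteField P j ℝ, (∀ y ∈ C, v y = 0) → ∑ x, v x ^ 2 ≤ CP * ℓ ^ 4 * ∑ x, laplace c v x ^ 2)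
    (hH : ∀ x ∈ C, φH x = φ x) (hEL : ∀ x ∉ C, laplace c (laplace c φH) x = 0)
    (hp : p = Real.sqrt (10 * P.d) * (Real.sqrt CP * ℓ ^ 2) * a * |c|) (hγ : γ = 15 / 4 * a * |c| * Real.sqrt P.d)
    (hA' : A' = 2 * (Real.sqrt CP * ℓ ^ 2) + 4 * p ^ 2) (hg₁ : g₁ = Real.sqrt (2 * A' + γ ^ 2 * A' ^ 2))
    (hτ : τ = Real.sqrt (10 * P.d) * (5 / 2 * a) * |c| * g₁ + Real.sqrt 3 * P.d * (2 * a ^ 2 + 2 * b) * c ^ 2 * A')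
    (H1 : p * γ + Real.sqrt 3 * P.d * b * c ^ 2 * (Real.sqrt CP * ℓ ^ 2) ≤ 1 / 4) (H2 : τ ≤ 1 / 2) :
    Real.sqrt (∑ x, (ω x * laplace c (fun y => φ y - φH y) x) ^ 2) ≤ 3 * Real.sqrt (∑ x, (ω x * laplace c φ x) ^ 2)
      ∧ Real.sqrt (∑ x, (ω x * (φ x - φH x)) ^ 2)
          ≤ A' * Real.sqrt (∑ x, (ω x * laplace c (fun y => φ y - φH y) x) ^ 2)
      ∧ Real.sqrt (∑ b, (ω b.src * grad c (fun y => φ y - φH y) b) ^ 2)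
          ≤ g₁ * Real.sqrt (∑ x, (ω x * laplace c (fun y => φ y - φH y) x) ^ 2) := by
  have he : ∀ y ∈ C, (fun y => φ y - φH y) y = 0 := fun y hy => by simp [hH y hy]
  have h := weighted_laplace_le_core c C ω (fun y => φ y - φH y) (laplace c φ) (fun _ => 0) (fun _ => 0) ha0 ha hb0
    (by positivity : (0 : ℝ) ≤ Real.sqrt CP * ℓ ^ 2) hω₀ hω₁ hω₂ (poincare_root_of_sq c C hCP hP) he
    (el_of_biharmonic_off c C φ φH hEL) hp hγ hA' hg₁ hτ H1 H2
  simp only [mul_zero, zero_pow two_ne_zero, Finset.sum_const_zero, Real.sqrt_zero, add_zero] at h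
  exact h

end Summit.QuantumFields.YangMills.Theorems.Prop7PinnedBiharmonicAgmonDecay

end
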